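import Summits.ABC.IUTFork.ForkGenuineDepthPerImage
import Summits.ABC.IUTFork.LDHGenuinePerImageSlotConstant
import Literature.IUT.LogVolume.PilotDataBaseChange
import HarnessLib

/-!
# The fork at [IUTchIII] Corollary 3.12 at a GENUINE input: along the slot-constant depth family readings (U) and (P) COINCIDE —
# one threshold for both (skeleton XXVIId-e; companion of the RISK-7 datum XXVIId-d)

Record-only file (D-0012) of the abc-iut cell (deliverable (a), skeleton seat abc-iut-skel, gen 8); TAKES NO SIDE.
XXVIId-d (`ForkGenuineDepthPerImage.lean`, p439611) showed that along abc-iut-w5-d018's ONE-PLACE family the cell's two readings of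
`−|log(Θ)|` — (U) hull of the union of the (Ind1)×(Ind2)-images, (P) hull per slot datum — part ways. For balance, HERE the
SLOT-CONSTANT family of abc-iut-w5-d157 (`deepAt p l N σ`: ALL places over `p` bad with the same scalar idele) is recorded in reading
(P): abc-iut-c312-d1's `DHData.cor312Of_iff_perImage_of_slotConstant` applies (its hypothesis — the canonical `log(q_v)`,
`DHData.logQloc`, constant on `V(F₀)_{p'}` at every support prime — is checked: `2lN·log p` over `p`, `0` elsewhere), so the (P)-form has
the SAME exact threshold as the (U)-form of XXVIId (`ForkGenuineDepthThreshold.lean`, p433731):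

* `logQloc_ofInput_deepAt_eq` / `logQloc_ofInput_deepAt_const` — the canonical `log(q_v)` of the synthetic input;
* **`cor312PerImageOf_deepAt_iff_cor312Of`** — `Cor312PerImageOf (deepAt N) ↔ Cor312Of (deepAt N)`;
* **`cor312PerImageOf_deepAt_iff_le_threshold`**, **`exists_nat_threshold_both_readings`** — one `N₀ : ℕ` with
  `Cor312Of (deepAt N) ↔ N ≤ N₀ ↔ Cor312PerImageOf (deepAt N)` for every depth `N ≥ 1`.

READING (VERDICT RISK ¶7 grammar; no side taken): the (U)/(P) distinction is invisible on slot-constant data (here) and decisive on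
non-slot-constant data (XXVIId-d) — in the kernel, along explicit families of genuine-completion inputs. HONEST SCOPE: synthetic ideles, NOT
initial Θ-data of [IUTchI] Def. 3.1; both `Cor312Of` and `Cor312PerImageOf` are CLAIM-forms, never asserted. PROOF-ONLY file: no
definitions, no `Prop` facts. [cite: Mochizuki2012, IUTchIII Cor. 3.12 p. 173–174, proof Step (x) p. 181] [cite: DupuyHilado2025, §3.3, §3.6,
Def. 3.6.3] [claim: Mochizuki2012, status: disputed]
-/

noncomputable section

open Set Module Literature.IUT.LogVolume NumberField IsDedekindDomain
open scoped Pointwise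

namespace Summit.ABC.IUTFork.GenuineContent

section SlotConstant

variable {F₀ : Type} [Field F₀] [NumberField F₀] {K : Type} [Field K] [NumberField K] [Algebra F₀ K]
variable (p : ℕ) [hp : Fact p.Prime] (l : ℕ) (hl : l.Prime) (h5 : 5 ≤ l) (σ : PlaceSection F₀ K)

/-- **The canonical `log(q_v)` of the synthetic input**: `2lN·log p` at every place over the deep prime, `0` at every other place
(`𝔮 = Σ_{v|p} 2lN·e_v·[v]`, `ln N(v) = f_v·log p`, `n_v = e_v f_v`). [cite: DupuyHilado2025, §3.3, §3.6] -/
theorem logQloc_ofInput_deepAt_eq (N : ℕ) (hN : 0 < N) (p' : ℕ) [hp' : Fact p'.Prime] (v : placesOver F₀ p') :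
    (DHData.ofInput (ThetaVolumeInput.deepAt p l hl h5 N hN σ)).logQloc p' v =
      if p' = p then 2 * (l : ℝ) * N * Real.log p else 0 := by
  classical
  unfold DHData.logQloc
  rw [DHData.ofInput_X]
  change (PilotData.deepAt F₀ p l hl h5 N hN).qDivisor v.1 * logNorm F₀ v.1 / localDegree F₀ v.1 = _
  rw [PilotData.qDivisor_apply]
  by_cases hpp : p' = p
  · subst hpp
    have hv : v.1 ∈ (PilotData.deepAt F₀ p' l hl h5 N hN).S := v.2
    rw [if_pos hv, if_pos rfl, PilotData.deepAt_ordq p' l hl h5 N hN v.1 v.2, logNorm_eq,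
      (mem_placesOver_iff_residueChar v.1).mp v.2, localDegree]
    have he : (ramIdx F₀ v.1 : ℝ) ≠ 0 := by exact_mod_cast ramIdx_ne_zero F₀ v.1
    have hf : (resDeg F₀ v.1 : ℝ) ≠ 0 := by exact_mod_cast resDeg_ne_zero F₀ v.1
    push_cast
    field_simp
  · have hv : v.1 ∉ (PilotData.deepAt F₀ p l hl h5 N hN).S := fun h => hpp
      (((mem_placesOver_iff_residueChar v.1).mp v.2).symm.trans ((mem_placesOver_iff_residueChar v.1).mp h))
    rw [if_neg hv, if_neg hpp, zero_mul, zero_div]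

/-- Hence `log(q_v)` is constant on `V(F₀)_{p'}` for every prime `p'` (abc-iut-c312-d1's slot-constancy hypothesis `hconst`).
[cite: DupuyHilado2025, §3.3, §3.6] -/
theorem logQloc_ofInput_deepAt_const (N : ℕ) (hN : 0 < N) (p' : ℕ) [Fact p'.Prime] (v w : placesOver F₀ p') :
    (DHData.ofInput (ThetaVolumeInput.deepAt p l hl h5 N hN σ)).logQloc p' v =
      (DHData.ofInput (ThetaVolumeInput.deepAt p l hl h5 N hN σ)).logQloc p' w := by
  rw [logQloc_ofInput_deepAt_eq, logQloc_ofInput_deepAt_eq]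

/-- **Readings (U) and (P) COINCIDE along the slot-constant family**: `Cor312PerImageOf (deepAt N) ↔ Cor312Of (deepAt N)` for every depth
(abc-iut-c312-d1's `cor312Of_iff_perImage_of_slotConstant`). [cite: Mochizuki2012, IUTchIII Cor. 3.12 p. 173–174, proof Step (x) p. 181]
[claim: Mochizuki2012, status: disputed] -/
theorem cor312PerImageOf_deepAt_iff_cor312Of (N : ℕ) (hN : 0 < N) :
    (ThetaVolumeInput.deepAt p l hl h5 N hN σ).Cor312PerImageOf ↔ (ThetaVolumeInput.deepAt p l hl h5 N hN σ).Cor312Of :=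
  (DHData.cor312Of_iff_perImage_of_slotConstant (ThetaVolumeInput.deepAt p l hl h5 N hN σ) fun p' hp' v w => by
    haveI : Fact p'.Prime := ⟨(ThetaVolumeInput.deepAt p l hl h5 N hN σ).prime_of_mem_supportPrimes hp'⟩
    exact logQloc_ofInput_deepAt_const p l hl h5 σ N hN p' v w).symm

/-- **… so the (P)-form has the SAME exact threshold**: `Cor312PerImageOf (deepAt p l N σ) ↔ N ≤ N₀(p,l,σ)` with the real threshold of XXVIId.
[cite: Mochizuki2012, IUTchIII Cor. 3.12 p. 173–174] [claim: Mochizuki2012, status: disputed] -/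
theorem cor312PerImageOf_deepAt_iff_le_threshold (N : ℕ) (hN : 0 < N) :
    (ThetaVolumeInput.deepAt p l hl h5 N hN σ).Cor312PerImageOf ↔
      (N : ℝ) ≤ ((ThetaVolumeInput.deepAt p l hl h5 1 Nat.one_pos σ).negLogTheta + ((l : ℝ) + 1) * l / 12 * Real.log p) /
        ((((l : ℝ) + 1) * l / 12 - 1) * Real.log p) := by
  rw [cor312PerImageOf_deepAt_iff_cor312Of, cor312Of_deepAt_iff_le_threshold]

/-- **ONE CROSSING FOR BOTH READINGS**: `∃ N₀ : ℕ, ∀ N ≥ 1, (Cor312Of (deepAt N) ↔ N ≤ N₀) ∧ (Cor312PerImageOf (deepAt N) ↔ N ≤ N₀)`.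
[cite: Mochizuki2012, IUTchIII Cor. 3.12 p. 173–174] [claim: Mochizuki2012, status: disputed] -/
theorem exists_nat_threshold_both_readings :
    ∃ N₀ : ℕ, ∀ (N : ℕ) (hN : 0 < N),
      ((ThetaVolumeInput.deepAt p l hl h5 N hN σ).Cor312Of ↔ N ≤ N₀) ∧
        ((ThetaVolumeInput.deepAt p l hl h5 N hN σ).Cor312PerImageOf ↔ N ≤ N₀) := by
  obtain ⟨N₀, hN₀⟩ := exists_nat_threshold p l hl h5 σ
  exact ⟨N₀, fun N hN => ⟨hN₀ N hN, (cor312PerImageOf_deepAt_iff_cor312Of p l hl h5 σ N hN).trans (hN₀ N hN)⟩⟩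

end SlotConstant

end Summit.ABC.IUTFork.GenuineContent

end
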